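import Mathlib
import HarnessLib

/-!
# Weighted order ideals `F_ρ = (uᵏ y₂ᵃ y₃ᵇ : k + d(a+b) ≥ ρ)` and their intersection

Topic: `Literature/AlgebraicGeometry/Resolution`. First piece of the completion-free treatment of
the "standard arguments" in the termination proof of Cossart–Piltant 2008, Prop. 4.4 (p. 11: an
infinite chain of near points with `τ = 2` follows a formal curve `Γ`, and then `Γ ⊆ Σ`): for
elements `u, y₂, y₃` of a commutative ring (in the application a regular system of parameters of
`𝒪_{X,x}`, `Γ = V(y₂, y₃)`), an integer weight `d ≥ 1` (`u` of weight `1`, `y₂, y₃` of weight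
`d`) and `ρ ∈ ℕ`, the ideal `weightedIdeal u y₂ y₃ d ρ` generated by the monomials
`uᵏ y₂ᵃ y₃ᵇ` with `k + d(a+b) ≥ ρ` — Hironaka's `{f : δ(f; u; y) ≥ d}`-type ideals
(Hironaka 1967; CoP1 p. 11 uses the polyhedron `Δ(J; u; y)` they define). PROVED:

* `monomial_mem_weightedIdeal`, `weightedIdeal_antitone`, `weightedIdeal_mul_le` (the `F_ρ` form a
  multiplicative filtration), `pow_span_le_weightedIdeal` (`(u, y₂, y₃)^ρ ⊆ F_ρ`);
* `weightedIdeal_le_sup` — `F^{(d)}_{dμ} ⊆ (y₂, y₃)^μ + (u^d)`;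
* `iInf_weightedIdeal_le` — **`⋂_{d ≥ 1} F^{(d)}_{dμ} ⊆ (y₂, y₃)^μ`** in a Noetherian local ring with
  `u ∈ 𝔪` (Krull's intersection theorem in `R/(y₂, y₃)^μ`): an ideal lying in all the weighted
  ideals `F^{(d)}_{dμ}` has order `≥ μ` along `V(y₂, y₃)`.

## Sources

* H. Hironaka, *Characteristic polyhedra of singularities*, J. Math. Kyoto Univ. 7 (1967) 251–293.
  [Hironaka1967]
* V. Cossart, O. Piltant, J. Algebra 320 (2008), proof of Prop. 4.4, p. 11. [CossartPiltant2008]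
-/

noncomputable section

open IsLocalRing

namespace Literature.AlgebraicGeometry.Resolution

universe u

variable {R : Type u} [CommRing R] (u y₂ y₃ : R)

/-- **The weighted order ideal** `F_ρ^{(d)} = (uᵏ y₂ᵃ y₃ᵇ : k + d(a + b) ≥ ρ)` (`u` of weight
`1`, `y₂, y₃` of weight `d`). [cite: Hironaka1967, §1] -/
def weightedIdeal (d ρ : ℕ) : Ideal R :=
  Ideal.span {m | ∃ k a b : ℕ, ρ ≤ k + d * (a + b) ∧ m = u ^ k * y₂ ^ a * y₃ ^ b}

/-- Monomials of weight `≥ ρ` lie in `F_ρ`. [folklore] -/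
theorem monomial_mem_weightedIdeal {d ρ k a b : ℕ} (h : ρ ≤ k + d * (a + b)) :
    u ^ k * y₂ ^ a * y₃ ^ b ∈ weightedIdeal u y₂ y₃ d ρ :=
  Ideal.subset_span ⟨k, a, b, h, rfl⟩

/-- `F_ρ` decreases with `ρ`. [folklore] -/
theorem weightedIdeal_antitone (d : ℕ) {ρ σ : ℕ} (h : ρ ≤ σ) :
    weightedIdeal u y₂ y₃ d σ ≤ weightedIdeal u y₂ y₃ d ρ := by
  refine Ideal.span_le.mpr ?_
  rintro _ ⟨k, a, b, hk, rfl⟩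
  exact monomial_mem_weightedIdeal u y₂ y₃ (h.trans hk)

/-- **`F_ρ · F_σ ⊆ F_{ρ+σ}`.** [folklore] -/
theorem weightedIdeal_mul_le (d ρ σ : ℕ) :
    weightedIdeal u y₂ y₃ d ρ * weightedIdeal u y₂ y₃ d σ ≤ weightedIdeal u y₂ y₃ d (ρ + σ) := by
  rw [weightedIdeal, weightedIdeal, Ideal.span_mul_span']
  refine Ideal.span_le.mpr ?_
  rintro _ ⟨_, ⟨k, a, b, hk, rfl⟩, _, ⟨k', a', b', hk', rfl⟩, rfl⟩
  have : u ^ k * y₂ ^ a * y₃ ^ b * (u ^ k' * y₂ ^ a' * y₃ ^ b') =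
      u ^ (k + k') * y₂ ^ (a + a') * y₃ ^ (b + b') := by ring
  change u ^ k * y₂ ^ a * y₃ ^ b * (u ^ k' * y₂ ^ a' * y₃ ^ b') ∈ _
  rw [this]
  refine monomial_mem_weightedIdeal u y₂ y₃ ?_
  nlinarith

/-- `F_ρ^n ⊆ F_{nρ}`. [folklore] -/
theorem weightedIdeal_pow_le (d ρ : ℕ) (n : ℕ) :
    weightedIdeal u y₂ y₃ d ρ ^ n ≤ weightedIdeal u y₂ y₃ d (n * ρ) := by
  induction n with
  | zero =>
    rw [pow_zero, Nat.zero_mul, Ideal.one_eq_top, top_le_iff, eq_top_iff]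
    intro x _
    have h1 : (1 : R) ∈ weightedIdeal u y₂ y₃ d 0 := by
      have := monomial_mem_weightedIdeal u y₂ y₃ (d := d) (ρ := 0) (k := 0) (a := 0) (b := 0) le_rfl
      simpa using this
    simpa using Ideal.mul_mem_left _ x h1
  | succ n ih =>
    rw [pow_succ, Nat.succ_mul]
    exact (Ideal.mul_mono ih le_rfl).trans (weightedIdeal_mul_le u y₂ y₃ d _ _)

/-- `u, y₂, y₃ ∈ F_1` for `d ≥ 1`, hence **`(u, y₂, y₃)^ρ ⊆ F_ρ`**. [folklore] -/
theorem pow_span_le_weightedIdeal {d : ℕ} (hd : 1 ≤ d) (ρ : ℕ) :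
    Ideal.span {u, y₂, y₃} ^ ρ ≤ weightedIdeal u y₂ y₃ d ρ := by
  have h1 : Ideal.span {u, y₂, y₃} ≤ weightedIdeal u y₂ y₃ d 1 := by
    refine Ideal.span_le.mpr ?_
    intro m hm
    simp only [Set.mem_insert_iff, Set.mem_singleton_iff] at hm
    rcases hm with rfl | rfl | rfl
    · simpa using monomial_mem_weightedIdeal m y₂ y₃ (d := d) (ρ := 1) (k := 1) (a := 0) (b := 0)
        (by omega)
    · simpa using monomial_mem_weightedIdeal u m y₃ (d := d) (ρ := 1) (k := 0) (a := 1) (b := 0)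
        (by omega)
    · simpa using monomial_mem_weightedIdeal u y₂ m (d := d) (ρ := 1) (k := 0) (a := 0) (b := 1)
        (by omega)
  calc Ideal.span {u, y₂, y₃} ^ ρ ≤ weightedIdeal u y₂ y₃ d 1 ^ ρ := Ideal.pow_right_mono h1 ρ
    _ ≤ weightedIdeal u y₂ y₃ d (ρ * 1) := weightedIdeal_pow_le u y₂ y₃ d 1 ρ
    _ = weightedIdeal u y₂ y₃ d ρ := by rw [Nat.mul_one]

/-- **`F^{(d)}_{dμ} ⊆ (y₂, y₃)^μ + (u^d)`**: a monomial `uᵏ y₂ᵃ y₃ᵇ` with `k + d(a+b) ≥ dμ` has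
`a + b ≥ μ` or `k ≥ d`. [cite: Hironaka1967, §1] -/
theorem weightedIdeal_le_sup (d μ : ℕ) :
    weightedIdeal u y₂ y₃ d (d * μ) ≤ Ideal.span {y₂, y₃} ^ μ ⊔ Ideal.span {u ^ d} := by
  refine Ideal.span_le.mpr ?_
  rintro _ ⟨k, a, b, hk, rfl⟩
  by_cases hab : μ ≤ a + b
  · refine Ideal.mem_sup_left ?_
    have hy : y₂ ^ a * y₃ ^ b ∈ Ideal.span {y₂, y₃} ^ (a + b) := by
      rw [pow_add]
      exact Ideal.mul_mem_mul (Ideal.pow_mem_pow (Ideal.subset_span (by simp)) a)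
        (Ideal.pow_mem_pow (Ideal.subset_span (by simp)) b)
    rw [mul_assoc]
    exact Ideal.mul_mem_left _ _ (Ideal.pow_le_pow_right hab hy)
  · refine Ideal.mem_sup_right ?_
    push Not at hab
    have hk' : d ≤ k := by
      have : d * (a + b) + d ≤ d * μ := by
        have : a + b + 1 ≤ μ := hab
        calc d * (a + b) + d = d * (a + b + 1) := by ring
          _ ≤ d * μ := Nat.mul_le_mul_left d this
      omega
    obtain ⟨c, rfl⟩ := Nat.exists_eq_add_of_le hk'
    rw [pow_add, mul_assoc, mul_assoc]
    exact Ideal.mul_mem_right _ _ (Ideal.subset_span rfl)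

/-- **`⋂_{d ≥ 1} F^{(d)}_{dμ} ⊆ (y₂, y₃)^μ`** in a Noetherian local ring with `u ∈ 𝔪` (Krull's
intersection theorem applied to the powers of `(u)` in `R/(y₂, y₃)^μ`). [cite: Hironaka1967, §1]
[cite: CossartPiltant2008, proof of Prop. 4.4, p. 11] -/
theorem iInf_weightedIdeal_le [IsNoetherianRing R] [IsLocalRing R] (hu : u ∈ maximalIdeal R) (μ : ℕ) :
    (⨅ d : ℕ, weightedIdeal u y₂ y₃ (d + 1) ((d + 1) * μ)) ≤ Ideal.span {y₂, y₃} ^ μ := by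
  intro f hf
  rw [Ideal.mem_iInf] at hf
  set P : Ideal R := Ideal.span {y₂, y₃} ^ μ with hP
  -- `f ∈ P + (u^{d})` for all `d ≥ 1`, i.e. the image of `f` in `R/P` lies in `⋂ (ū)^d = 0`
  have hmem : ∀ d : ℕ, Ideal.Quotient.mk P f ∈ (Ideal.span {Ideal.Quotient.mk P u}) ^ (d + 1) := by
    intro d
    have h1 := weightedIdeal_le_sup u y₂ y₃ (d + 1) μ (hf d)
    obtain ⟨p, hp, q, hq, hpq⟩ := Submodule.mem_sup.mp h1
    obtain ⟨c, rfl⟩ := Ideal.mem_span_singleton'.mp hq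
    rw [← hpq, map_add, Ideal.Quotient.eq_zero_iff_mem.mpr hp, zero_add, map_mul, map_pow,
      Ideal.span_singleton_pow]
    exact Ideal.mul_mem_left _ _ (Ideal.subset_span rfl)
  by_cases hPtop : P = ⊤
  · rw [hPtop]; exact Submodule.mem_top
  haveI : Nontrivial (R ⧸ P) := Ideal.Quotient.nontrivial_iff.mpr hPtop
  haveI : IsLocalRing (R ⧸ P) :=
    IsLocalRing.of_surjective' (Ideal.Quotient.mk P) Ideal.Quotient.mk_surjective
  -- `(ū) ≠ ⊤` since `u ∈ 𝔪 ⊇ P`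
  have hI : Ideal.span {Ideal.Quotient.mk P u} ≠ ⊤ := by
    intro htop
    have hunit : IsUnit (Ideal.Quotient.mk P u) := Ideal.span_singleton_eq_top.mp htop
    obtain ⟨v, hv⟩ := hunit.exists_right_inv
    obtain ⟨v, rfl⟩ := Ideal.Quotient.mk_surjective v
    rw [← map_mul, ← map_one (Ideal.Quotient.mk P), Ideal.Quotient.eq] at hv
    have h1 : u * v - 1 ∈ maximalIdeal R := (le_maximalIdeal hPtop) hv
    have h2 : u * v ∈ maximalIdeal R := Ideal.mul_mem_right _ _ hu
    have h3 := sub_mem h2 h1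
    rw [sub_sub_cancel] at h3
    exact (maximalIdeal.isMaximal R).ne_top (Ideal.eq_top_of_isUnit_mem _ h3 isUnit_one)
  have hkrull := Ideal.iInf_pow_eq_bot_of_isLocalRing (Ideal.span {Ideal.Quotient.mk P u}) hI
  have hf0 : Ideal.Quotient.mk P f ∈ ⨅ n : ℕ, Ideal.span {Ideal.Quotient.mk P u} ^ n := by
    rw [Ideal.mem_iInf]
    intro n
    cases n with
    | zero => rw [pow_zero, Ideal.one_eq_top]; exact Submodule.mem_top
    | succ n => exact hmem n
  rw [hkrull, Ideal.mem_bot] at hf0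
  exact Ideal.Quotient.eq_zero_iff_mem.mp hf0

end Literature.AlgebraicGeometry.Resolution

end
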